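import Literature.Topology.FourManifolds.CircleSurgeryEulerModels
import Literature.AlgebraicTopology.SingularHomology.CompactManifoldFiniteness
import Literature.AlgebraicTopology.SingularHomology.FundamentalClassProofs
import HarnessLib

/-!
# The Euler characteristic of a circle surgery: `χ(X_ℓ) = χ(X) + 2`

Topic `Literature/Topology/FourManifolds`.  R. E. Gompf, A. I. Stipsicz, *4-Manifolds and Kirby
Calculus* (1999), §5.2 / A. Kosinski, *Differential Manifolds* (1993), VI (9.2), (10.1), VII §1:
surgery on a circle `ℓ` in a closed 4-manifold `X` replaces `S¹ × B³` (`χ = 0`) by `D² × S²`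
(`χ = 2`) along `S¹ × S²` (`χ = 0`), so that `χ(X_ℓ) = χ(X) + 2`; R. Kirby, *The Topology of
4-Manifolds* (1989), I §2: surgery on a circle trades a `1`-handle for a `2`-handle.

This file PROVES it for the tree's relational circle surgery
`Literature.Topology.FourManifolds.IsCircleSurgery (𝓡 4) (𝓡 4) X P ℓ` (either framing) between
CLOSED topological 4-manifolds (`T2Space`, `CompactSpace`, charted on `ℝ⁴`; no smoothness of the
gluing is used), with the Euler characteristic the tree's `relEuler ℤ ℤ · ∅` and finiteness of
the homology recorded as `FinRelHomology`:

* `finRelHomology_left_and_relEuler_of_isOpen_cover` — a variant of the tree's two-set count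
  `finRelHomology_and_relEuler_of_isOpen_cover` (`ConnectedSumEulerCharacteristic.lean`):
  **if `Y = U ∪ V` (open) and `Y`, `V`, `U ∩ V` have homology of finite type, then so does `U`,
  and `χ(Y) = χ(U) + χ(V) - χ(U ∩ V)`** (triples `∅ ⊆ U ⊆ Y`, `∅ ⊆ U ∩ V ⊆ V` and excision;
  Hatcher Thm. 2.44, Thm. 2.20, §2.1 p. 118; the tree's `FinRelHomology.triple_left/right`);
* `nonempty_homotopyEquiv_puncturedCore`, `finRelHomology_puncturedCore` — the overlap model
  `(D̊² ∖ 0) × S² ≃ₕ S¹ × S²`, `χ = 0`;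
* `finRelHomology_and_relEuler_of_isCircleSurgery` — **`χ(P) = χ(X) + 2`** for
  `IsCircleSurgery (𝓡 4) (𝓡 4) X P ℓ`: cover `X` by `X ∖ ℓ(S¹)` and the tube `ν(S¹ × ℝ³)`
  (`χ = 0`, overlap `ν(S¹ × (ℝ³ ∖ 0))`, `χ = 0`), and `P` by the images of `X ∖ ℓ(S¹)` and of
  `D̊² × S²` (`χ = 2`, overlap `(D̊² ∖ 0) × S²`, `χ = 0`); the finite type of the homology of the
  closed manifolds `X`, `P` is the tree's `finite_singularHomology_of_compactSpace_holds` /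
  `isZero_singularHomology_of_lt_holds`, that of `X ∖ ℓ(S¹)` follows from the first cover.

Everything is proved; no definitions, no named facts.

## References

* R. E. Gompf, A. I. Stipsicz, *4-Manifolds and Kirby Calculus*, GSM 20 (1999), §5.2.
  [GompfStipsiczGSM1999]
* A. Kosinski, *Differential Manifolds* (1993), Ch. VI (9.2), (10.1), Ch. VII §1. [Kosinski1993]
* R. C. Kirby, *The Topology of 4-Manifolds*, LNM 1374 (1989), Ch. I §2. [Kirby1989]
* A. Hatcher, *Algebraic Topology* (2002), §2.1 p. 118, Thm. 2.20, Thm. 2.26, Thm. 2.44.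
  [HatcherAT2002]
-/

noncomputable section

open Set Function CategoryTheory CategoryTheory.Limits Module
open scoped Manifold ContDiff Topology unitInterval
open Literature.AlgebraicTopology.SingularHomology

namespace Literature.Topology.FourManifolds

/-! ### A two-set count that PRODUCES the finite type of one piece -/

/-- **`χ(U ∪ V) = χ(U) + χ(V) - χ(U ∩ V)`, the finite type of `U` being a CONCLUSION.**  Let
`Y = U ∪ V` with `U`, `V` open, and suppose the integral homology of `Y` (finite type below
`N + 1`), of `V` and of `U ∩ V` (below `N`) is finitely generated.  Then the homology of `U` is
finitely generated and vanishes from degree `N + 1` on, and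
`χ(Y) = χ(U) + χ(V) - χ(U ∩ V)`.  Proof by triples (Hatcher 2002, §2.1 p. 118, Thm. 2.44):
`χ(V) = χ(U ∩ V) + χ(V, U ∩ V)` (`FinRelHomology.triple_right` in `V`),
`χ(V, U ∩ V) = χ(Y, U)` by excision (Thm. 2.20, `isIso_map_of_interior_union_interior_holds`),
and `χ(Y) = χ(U) + χ(Y, U)` with the finiteness of `H_•(U)` from that of `H_•(Y)` and
`H_•(Y, U)` (`FinRelHomology.triple_left`).
[cite: HatcherAT2002, §2.2 Thm. 2.44 (proof), §2.1 p. 118, Thm. 2.20] -/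
theorem finRelHomology_left_and_relEuler_of_isOpen_cover {Y : Type} [TopologicalSpace Y]
    {U V : Set Y} (hU : IsOpen U) (hV : IsOpen V) (hUV : U ∪ V = univ) {N : ℕ}
    (hFY : FinRelHomology ℤ ℤ Y ∅ (N + 1)) (hFV : FinRelHomology ℤ ℤ ↥V ∅ N)
    (hFUV : FinRelHomology ℤ ℤ ↥(U ∩ V) ∅ N) :
    FinRelHomology ℤ ℤ ↥U ∅ (N + 1) ∧
      relEuler ℤ ℤ Y ∅ = relEuler ℤ ℤ ↥U ∅ + relEuler ℤ ℤ ↥V ∅ - relEuler ℤ ℤ ↥(U ∩ V) ∅ := by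
  have hint : interior U ∪ interior V = univ := by rw [hU.interior_eq, hV.interior_eq, hUV]
  -- the trace `W = V ↓∩ U` of `U` on `V` is a copy of `U ∩ V`
  let e : ↥(U ∩ V) ≃ₜ ↥(Subtype.val ⁻¹' U : Set ↥V) :=
    (Homeomorph.setCongr (inter_comm U V)).trans (preimageValHomeomorph V U).symm
  have hW : FinRelHomology ℤ ℤ ↥(Subtype.val ⁻¹' U : Set ↥V) (Subtype.val ⁻¹' ∅) N :=
    (hFUV.of_homeomorph e (mapsTo_empty _ _) (mapsTo_empty _ _)).congr_set (preimage_empty).symm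
  have hWe : relEuler ℤ ℤ ↥(Subtype.val ⁻¹' U : Set ↥V) (Subtype.val ⁻¹' ∅) =
      relEuler ℤ ℤ ↥(U ∩ V) ∅ := by
    rw [relEuler_congr_set (R := ℤ) (M := ℤ) (X := ↥(Subtype.val ⁻¹' U : Set ↥V))
      (preimage_empty (f := (Subtype.val : ↥(Subtype.val ⁻¹' U : Set ↥V) → ↥V)))]
    exact (relEuler_eq_of_homeomorph (R := ℤ) (M := ℤ) (A := (∅ : Set ↥(U ∩ V))) e
      (mapsTo_empty _ _) (mapsTo_empty _ _)).symm
  -- (1) the triple `∅ ⊆ W ⊆ V` in `V`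
  obtain ⟨hVW, hVWe⟩ := FinRelHomology.triple_right (R := ℤ) (M := ℤ)
    (empty_subset (Subtype.val ⁻¹' U : Set ↥V)) hW hFV
  -- (2) excision `H_•(V, W) ≅ H_•(Y, U)`
  have hexc := relativeSingularHomology.isIso_map_of_interior_union_interior_holds ℤ ℤ Y U V hint
  let ex : ∀ k, relativeSingularHomology ℤ ℤ ↥V (Subtype.val ⁻¹' U) k ≅
      relativeSingularHomology ℤ ℤ Y U k := fun k =>
    @asIso _ _ _ _ (relativeSingularHomology.map ℤ ℤ (X := ↥V) (subsetIncl V)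
      (mapsTo_preimage Subtype.val U : MapsTo _ (Subtype.val ⁻¹' U) U) k) (hexc k)
  have hYU : FinRelHomology ℤ ℤ Y U (N + 1) := hVW.of_iso ex
  have hYUe : relEuler ℤ ℤ ↥V (Subtype.val ⁻¹' U) = relEuler ℤ ℤ Y U := relEuler_eq_of_iso ex
  -- (3) the triple `∅ ⊆ U ⊆ Y` in `Y`, the finiteness of `H_•(U)` being a conclusion
  obtain ⟨hU', hYe⟩ := FinRelHomology.triple_left (R := ℤ) (M := ℤ) (empty_subset U) hFY hYU
  refine ⟨hU'.congr_set preimage_empty, ?_⟩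
  rw [hYe, relEuler_congr_set (R := ℤ) (M := ℤ) (X := ↥U)
    (preimage_empty (f := (Subtype.val : ↥U → Y))), ← hYUe]
  rw [hWe] at hVWe
  linarith

/-! ### The punctured new piece `(D̊² ∖ 0) × S²` -/

/-- **`(D̊² ∖ 0) × S² ≃ₕ S¹ × S²`**: radial retraction of the punctured disc onto the circle of
radius `1/2`, `w ↦ w / ‖w‖`, homotopy inverse to `u ↦ u / 2` through `((1 - t)/(2‖w‖) + t) w`,
which stays in the punctured open disc (Hatcher 2002, proof of Thm. 2.26).
[cite: HatcherAT2002, Thm. 2.26 (proof)] -/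
theorem nonempty_homotopyEquiv_puncturedCore :
    Nonempty (ContinuousMap.HomotopyEquiv
      ↥{b : ↥discTimesSphere |
        (b : EuclideanSpace ℝ (Fin 2) × ↥(Metric.sphere (0 : EuclideanSpace ℝ (Fin 3)) 1)).1 ≠ 0}
      (↥(Metric.sphere (0 : EuclideanSpace ℝ (Fin 2)) 1) ×
        ↥(Metric.sphere (0 : EuclideanSpace ℝ (Fin 3)) 1))) := by
  let E2 := EuclideanSpace ℝ (Fin 2)
  let S2 := ↥(Metric.sphere (0 : EuclideanSpace ℝ (Fin 3)) 1)
  let puncturedCoreSet : Set ↥discTimesSphere := {b | ((b : ↥discTimesSphere) : E2 × S2).1 ≠ 0}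
  change Nonempty (ContinuousMap.HomotopyEquiv ↥puncturedCoreSet (↥(Metric.sphere (0 : E2) 1) × S2))
  -- coordinates of a point of the punctured new piece
  let w : ↥puncturedCoreSet → E2 := fun b => ((b : ↥discTimesSphere) : E2 × S2).1
  let v : ↥puncturedCoreSet → S2 := fun b => ((b : ↥discTimesSphere) : E2 × S2).2
  have hwc : Continuous w := continuous_fst.comp (continuous_subtype_val.comp continuous_subtype_val)
  have hvc : Continuous v := continuous_snd.comp (continuous_subtype_val.comp continuous_subtype_val)
  have hne : ∀ b, w b ≠ 0 := fun b => b.2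
  have hpos : ∀ b, 0 < ‖w b‖ := fun b => norm_pos_iff.2 (hne b)
  have hlt : ∀ b, ‖w b‖ < 1 := fun b => b.1.2
  -- the radial retraction
  have hgm : ∀ b, ‖w b‖⁻¹ • w b ∈ Metric.sphere (0 : E2) 1 := fun b => by
    rw [mem_sphere_zero_iff_norm, norm_smul, norm_inv, norm_norm, inv_mul_cancel₀ (hpos b).ne']
  have hgc : Continuous fun b => ‖w b‖⁻¹ • w b := (hwc.norm.inv₀ fun b => (hpos b).ne').smul hwc
  let g : C(↥puncturedCoreSet, ↥(Metric.sphere (0 : E2) 1) × S2) :=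
    ⟨fun b => (⟨‖w b‖⁻¹ • w b, hgm b⟩, v b), (hgc.subtype_mk hgm).prodMk hvc⟩
  -- the inclusion at radius `1/2`
  have hS : ∀ u : ↥(Metric.sphere (0 : E2) 1), ‖(u : E2)‖ = 1 := fun u => by
    have h := u.2; rwa [mem_sphere_zero_iff_norm] at h
  have hfm1 : ∀ q : ↥(Metric.sphere (0 : E2) 1) × S2,
      (((1 / 2 : ℝ) • (q.1 : E2), q.2) : E2 × S2) ∈ discTimesSphere := fun q => by
    rw [mem_discTimesSphere_iff, norm_smul, hS q.1]
    norm_num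
  have hfm2 : ∀ q : ↥(Metric.sphere (0 : E2) 1) × S2,
      (⟨((1 / 2 : ℝ) • (q.1 : E2), q.2), hfm1 q⟩ : ↥discTimesSphere) ∈ puncturedCoreSet := fun q => by
    change (1 / 2 : ℝ) • (q.1 : E2) ≠ 0
    refine smul_ne_zero (by norm_num) ?_
    rw [← norm_ne_zero_iff, hS q.1]
    exact one_ne_zero
  let f : C(↥(Metric.sphere (0 : E2) 1) × S2, ↥puncturedCoreSet) :=
    ⟨fun q => ⟨⟨((1 / 2 : ℝ) • (q.1 : E2), q.2), hfm1 q⟩, hfm2 q⟩,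
      (Continuous.subtype_mk (by fun_prop) hfm1).subtype_mk hfm2⟩
  have hgf : g.comp f = ContinuousMap.id _ := by
    ext q : 1
    obtain ⟨u, s⟩ := q
    refine Prod.ext (Subtype.ext ?_) rfl
    simp only [ContinuousMap.comp_apply, ContinuousMap.coe_mk, ContinuousMap.id_apply, f, g, w]
    rw [norm_smul, hS u, smul_smul]
    norm_num
  -- the straight-line homotopy from `f ∘ g` to the identity, inside the punctured new piece
  let c : I → ↥puncturedCoreSet → ℝ := fun t b => (1 - (t : ℝ)) * (2 * ‖w b‖)⁻¹ + (t : ℝ)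
  have hc : ∀ t b, 0 < c t b ∧ c t b * ‖w b‖ < 1 := by
    intro t b
    have hb0 := hpos b
    have hb1 := hlt b
    have ht0 : 0 ≤ (t : ℝ) := t.2.1
    have ht1 : (t : ℝ) ≤ 1 := t.2.2
    have hkey : c t b * ‖w b‖ = (1 - (t : ℝ)) * (1 / 2) + (t : ℝ) * ‖w b‖ := by
      simp only [c]; field_simp
    constructor
    · have hi : 0 < (2 * ‖w b‖)⁻¹ := by positivity
      rcases eq_or_lt_of_le ht0 with h0 | h0
      · simp only [c, ← h0]; simpa using hi
      · simp only [c]; nlinarith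
    · rw [hkey]; nlinarith
  have hmem1 : ∀ t b, ((c t b • w b, v b) : E2 × S2) ∈ discTimesSphere := fun t b => by
    rw [mem_discTimesSphere_iff, norm_smul, Real.norm_eq_abs, abs_of_pos (hc t b).1]
    exact (hc t b).2
  have hmem2 : ∀ t b, (⟨(c t b • w b, v b), hmem1 t b⟩ : ↥discTimesSphere) ∈ puncturedCoreSet :=
    fun t b => smul_ne_zero (hc t b).1.ne' (hne b)
  have hHc : Continuous fun q : I × ↥puncturedCoreSet => ((c q.1 q.2 • w q.2, v q.2) : E2 × S2) := by
    have h2 : Continuous fun q : I × ↥puncturedCoreSet => w q.2 := hwc.comp continuous_snd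
    have h1 : Continuous fun q : I × ↥puncturedCoreSet => (q.1 : ℝ) :=
      continuous_subtype_val.comp continuous_fst
    have h3 : Continuous fun q : I × ↥puncturedCoreSet => c q.1 q.2 :=
      ((continuous_const.sub h1).mul
        ((continuous_const.mul h2.norm).inv₀ fun q => mul_ne_zero two_ne_zero (hpos q.2).ne')).add h1
    exact (h3.smul h2).prodMk (hvc.comp continuous_snd)
  let H : (f.comp g).Homotopy (ContinuousMap.id ↥puncturedCoreSet) :=
    { toFun := fun q => ⟨⟨(c q.1 q.2 • w q.2, v q.2), hmem1 q.1 q.2⟩, hmem2 q.1 q.2⟩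
      continuous_toFun := (hHc.subtype_mk fun q => hmem1 q.1 q.2).subtype_mk fun q => hmem2 q.1 q.2
      map_zero_left := fun b => by
        apply Subtype.ext; apply Subtype.ext
        simp only [ContinuousMap.comp_apply, ContinuousMap.coe_mk, f, g, c, w, v]
        refine Prod.ext ?_ rfl
        simp only [Set.Icc.coe_zero, sub_zero, one_mul, add_zero]
        rw [smul_smul]
        congr 1
        rw [mul_inv]
        ring
      map_one_left := fun b => by
        apply Subtype.ext; apply Subtype.ext
        simp [c, w, v] }
  exact
    ⟨{ toFun := g
       invFun := f
       left_inv := ⟨H⟩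
       right_inv := by rw [hgf] }⟩

/-- **`χ((D̊² ∖ 0) × S²) = 0`, with finiteness** (`≃ₕ S¹ × S²`, `χ(S¹ × S²) = 0`).
[cite: HatcherAT2002, Cor. 2.11 and Thm. 2.44] -/
theorem finRelHomology_puncturedCore :
    FinRelHomology ℤ ℤ ↥{b : ↥discTimesSphere |
        (b : EuclideanSpace ℝ (Fin 2) × ↥(Metric.sphere (0 : EuclideanSpace ℝ (Fin 3)) 1)).1 ≠ 0} ∅ 4 ∧
      relEuler ℤ ℤ ↥{b : ↥discTimesSphere |
        (b : EuclideanSpace ℝ (Fin 2) × ↥(Metric.sphere (0 : EuclideanSpace ℝ (Fin 3)) 1)).1 ≠ 0} ∅ = 0 :=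
  finRelHomology_and_relEuler_of_homotopyEquiv nonempty_homotopyEquiv_puncturedCore.some.symm
    finRelHomology_sphereOne_prod_sphereTwo


/-! ### `χ(X_ℓ) = χ(X) + 2` -/

/-- Finite type of the homology of a closed topological `4`-manifold (Hatcher 2002, Cor. A.8/A.9
and Prop. 3.29; the tree's `finite_singularHomology_of_compactSpace_holds`,
`isZero_singularHomology_of_lt_holds`). [cite: HatcherAT2002, Appendix A Cor. A.8 and A.9] -/
theorem finRelHomology_of_closed_four {M : Type} [TopologicalSpace M] [T2Space M] [CompactSpace M]
    [ChartedSpace (EuclideanSpace ℝ (Fin 4)) M] : FinRelHomology ℤ ℤ M ∅ 5 :=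
  FinRelHomology.empty_of_absolute
    (fun j => finite_singularHomology_of_compactSpace_holds ℤ M 4 j)
    (fun _ hj => isZero_singularHomology_of_lt_holds ℤ ℤ M 4 (by omega))

/-- **The Euler characteristic of a circle surgery: `χ(X_ℓ) = χ(X) + 2`** (Gompf–Stipsicz 1999,
§5.2; Kosinski 1993, VI (9.2)/(10.1), VII §1).  Let the closed topological `4`-manifold `P` be
obtained from the closed topological `4`-manifold `X` by surgery on the circle `ℓ : S¹ → X` in
the sense of `Literature.Topology.FourManifolds.IsCircleSurgery (𝓡 4) (𝓡 4) X P ℓ` (a tube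
`ν : S¹ × ℝ³ ↪ X` around `ℓ`; `P` the open gluing of `X ∖ ℓ(S¹)` and `D̊² × S²` along
`circleSurgeryRel ν`; either framing).  Then the integral homology of `X` and `P` is of finite
type and `χ(P) = χ(X) + 2`.  Proof: `X = (X ∖ ℓ(S¹)) ∪ ν(S¹ × ℝ³)` with
`χ(S¹ × ℝ³) = 0`, overlap `ν(S¹ × (ℝ³ ∖ 0))`, `χ = 0`, so `χ(X) = χ(X ∖ ℓ(S¹))`
(`finRelHomology_left_and_relEuler_of_isOpen_cover`, which also yields the finite type of
`X ∖ ℓ(S¹)`); `P = jA(X ∖ ℓ(S¹)) ∪ jB(D̊² × S²)` with `χ(D̊² × S²) = 2`, overlap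
`jB((D̊² ∖ 0) × S²)` (`CircleSurgeryDatum.range_jA_inter_range_jB`), `χ = 0`, so
`χ(P) = χ(X ∖ ℓ(S¹)) + 2` (`finRelHomology_and_relEuler_of_isOpen_cover`).
[cite: GompfStipsiczGSM1999, §5.2] [cite: Kosinski1993, Ch. VI (9.2) and (10.1), Ch. VII §1] -/
theorem finRelHomology_and_relEuler_of_isCircleSurgery {X P : Type} [TopologicalSpace X] [T2Space X]
    [CompactSpace X] [ChartedSpace (EuclideanSpace ℝ (Fin 4)) X]
    {ℓ : ↥(Metric.sphere (0 : EuclideanSpace ℝ (Fin 2)) 1) → X}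
    [TopologicalSpace P] [T2Space P] [CompactSpace P] [ChartedSpace (EuclideanSpace ℝ (Fin 4)) P]
    (h : IsCircleSurgery (𝓡 4) (𝓡 4) X P ℓ) :
    FinRelHomology ℤ ℤ X ∅ 5 ∧ FinRelHomology ℤ ℤ P ∅ 5 ∧
      relEuler ℤ ℤ P ∅ = relEuler ℤ ℤ X ∅ + 2 := by
  obtain ⟨G⟩ := h.nonempty_circleSurgeryDatum
  have hX : FinRelHomology ℤ ℤ X ∅ 5 := finRelHomology_of_closed_four
  have hP : FinRelHomology ℤ ℤ P ∅ 5 := finRelHomology_of_closed_four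
  refine ⟨hX, hP, ?_⟩
  -- abbreviations for the model spaces
  let S1 := ↥(Metric.sphere (0 : EuclideanSpace ℝ (Fin 2)) 1)
  let E3 := EuclideanSpace ℝ (Fin 3)
  -- ### the cover of `X` by the circle complement and the tube
  let ν := G.ν
  let U : Set X := (Set.range ℓ)ᶜ
  let V : Set X := Set.range ν.toFun
  have hUo : IsOpen U := ν.isClosed_range_curve.isOpen_compl
  have hVo : IsOpen V := ν.isOpen_range
  have hcov : U ∪ V = univ := by
    refine Set.eq_univ_of_forall fun x => ?_
    by_cases hx : x ∈ Set.range ℓ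
    · obtain ⟨u, rfl⟩ := hx
      exact Or.inr ⟨(u, 0), ν.apply_zero u⟩
    · exact Or.inl hx
  have hUV : U ∩ V = ν.toFun '' ((Set.univ : Set S1) ×ˢ ({0}ᶜ : Set E3)) := by
    ext x
    simp only [U, V, Set.mem_inter_iff, Set.mem_compl_iff, Set.mem_range, Set.mem_image,
      Set.mem_prod, Set.mem_univ, true_and, Set.mem_singleton_iff]
    constructor
    · rintro ⟨hxℓ, ⟨u, v⟩, rfl⟩
      refine ⟨(u, v), ?_, rfl⟩
      rintro rfl
      exact hxℓ ⟨u, (ν.apply_zero u).symm⟩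
    · rintro ⟨⟨u, v⟩, hv, rfl⟩
      refine ⟨?_, (u, v), rfl⟩
      rintro ⟨u', hu'⟩
      have hinj := ν.isSmoothEmbedding.isEmbedding.injective ((ν.apply_zero u').trans hu')
      exact hv (congrArg Prod.snd hinj).symm
  -- finite type and `χ` of the tube and of the punctured tube
  have hFV : FinRelHomology ℤ ℤ ↥V ∅ 2 ∧ relEuler ℤ ℤ ↥V ∅ = 0 :=
    finRelHomology_and_relEuler_of_homeomorph ν.isSmoothEmbedding.isEmbedding.toHomeomorph
      finRelHomology_sphereOne_prod_space
  have hFUV : FinRelHomology ℤ ℤ ↥(U ∩ V) ∅ 4 ∧ relEuler ℤ ℤ ↥(U ∩ V) ∅ = 0 :=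
    finRelHomology_and_relEuler_of_homeomorph
      ((ν.isSmoothEmbedding.isEmbedding.homeomorphImage _).trans (Homeomorph.setCongr hUV.symm))
      finRelHomology_puncturedTube
  obtain ⟨hFU, hχX⟩ := finRelHomology_left_and_relEuler_of_isOpen_cover hUo hVo hcov hX
    (hFV.1.mono (show 2 ≤ 4 by norm_num)) hFUV.1
  -- ### the cover of `P` by the images of the circle complement and of the new piece
  let U' : Set P := Set.range G.jA
  let V' : Set P := Set.range G.jB
  have hU'V' : U' ∩ V' = G.jB '' {b : ↥discTimesSphere |
      (b : EuclideanSpace ℝ (Fin 2) × ↥(Metric.sphere (0 : EuclideanSpace ℝ (Fin 3)) 1)).1 ≠ 0} :=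
    G.range_jA_inter_range_jB
  -- `jA(X ∖ ℓ) ≅ X ∖ ℓ`, `jB(D̊² × S²) ≅ D̊² × S²`, overlap `≅ (D̊² ∖ 0) × S²`
  let eU : ↥U ≃ₜ ↥U' := G.hA.toHomeomorph
  have hFU' : FinRelHomology ℤ ℤ ↥U' ∅ 5 :=
    hFU.of_homeomorph eU (mapsTo_empty _ _) (mapsTo_empty _ _)
  have hUe : relEuler ℤ ℤ ↥U ∅ = relEuler ℤ ℤ ↥U' ∅ :=
    relEuler_eq_of_homeomorph (R := ℤ) (M := ℤ) (A := (∅ : Set ↥U)) eU (mapsTo_empty _ _)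
      (mapsTo_empty _ _)
  have hFV' : FinRelHomology ℤ ℤ ↥V' ∅ 3 ∧ relEuler ℤ ℤ ↥V' ∅ = 2 :=
    finRelHomology_and_relEuler_of_homeomorph G.hB.toHomeomorph finRelHomology_discTimesSphere
  have hFU'V' : FinRelHomology ℤ ℤ ↥(U' ∩ V') ∅ 4 ∧ relEuler ℤ ℤ ↥(U' ∩ V') ∅ = 0 :=
    finRelHomology_and_relEuler_of_homeomorph
      ((G.hB.homeomorphImage _).trans (Homeomorph.setCongr hU'V'.symm)) finRelHomology_puncturedCore
  obtain ⟨-, hχP⟩ := finRelHomology_and_relEuler_of_isOpen_cover G.hAo G.hBo G.hU hFU'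
    (hFV'.1.mono (show 3 ≤ 5 by norm_num)) (hFU'V'.1.mono (show 4 ≤ 5 by norm_num))
  -- ### count
  rw [hχP, hχX, hFV.2, hFUV.2, hFV'.2, hFU'V'.2, hUe]
  ring

end Literature.Topology.FourManifolds

end
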